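import Summits.BirchSwinnertonDyer.BirchSwinnertonDyer.Theorems.EisensteinPrimesGoodLatticeAnacongPlacementOfKriz
import Summits.BirchSwinnertonDyer.BirchSwinnertonDyer.Theorems.EisensteinPrimesGoodLatticeBDPValueKatzUnitSuppliers
import Literature.NumberTheory.EllipticCurves.CastellaGrossiLeeSkinner2022.EisensteinCongruenceOfFullDescent
import HarnessLib

/-!
# Content stub 3a-A of crux 2 `GoodLatticeBDPValue` from CASTELLA–GROSSI–LEE–SKINNER'S PROOF OF THM. 2.2.1 and HIDA'S THM. I,
# GIVEN a full-Eisenstein-descent type — the producer side of director-bsd key (β)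
# (cell `bsd-eis`, width seat `bsd-line-x1-p1-w2` gen 26; `--supports stmt-BirchSwinnertonDyer-19032`)

WHY. Crux 2 [-19032] (line `halves` v33N) is closed BY NAME modulo five published facts and the content stub 3a-A
`KellerYin2024.thm222_anacong_goodLattice_of_fullDescentDatum` (composed print, referee C3). -w2 g26 landed the CONSUMER
`GoodLatticeAnacongOfEisensteinCongruence.anacong_conclusion_of_eisensteinCongruence` (p757455): 3a-A's conclusion ⟸ a CGLS
Thm. 2.2.1-shaped congruence ∧ `μ(L_φ) = 0`. The producer is ONE named fact — CGLS's PROOF of Thm. 2.2.1 from (eq:cong-mf), with (eq:cong-mf) entered through Kriz's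
Def. 31 (full Eisenstein descent of a type): `CastellaGrossiLeeSkinner2022.proofThm221_congruence_of_fullEisensteinDescent`
(`Literature/NumberTheory/EllipticCurves/CastellaGrossiLeeSkinner2022/EisensteinCongruenceOfFullDescent.lean`, this seat). THIS
FILE assembles: `anacong_of_proofThm221_of_thmI` — that fact ∧ `Hida2010MuInvariant.thmI_mu_katzLFunction_eq_zero` ⟹ the conclusion of 3a-A at
the call shape of the tree's consumers of [AN] (ℚ-Teichmüller pair on the rational line, restricted to `K`, `Cbar` any ramified
set), GIVEN a full-descent type `(N₊, N₋, N₀)` with Kriz's (1)–(5). What then remains of 3a-A outside print + kernel is the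
EXISTENCE of such a type from `Red W p` + the full-descent datum (Kriz Thm. 34 (3)/35: traces and Tate-curve scalars; Def. 31 (5)
as `0 ≡ 0` under the datum, `δ = 0` for `φ ≠ 𝟙`) — kernel-sized, not attempted here.

HONEST FRAMING: theorems only (0 definitions, 0 named facts in this file, 0 sorry); CONDITIONAL on the named fact (a PUBLISHED
proof step, typed WEAKER than print — see its docstring) and on Hida's Thm. I by name; no `p`-adic `L`-function is constructed; closes no stub by itself (the
LEAD decides whether to restub 3a-A through it); 0 cells / labels / tiers move; no summit statement, no case of BSD, no theorem
of CGLS / Kriz / Hida / Keller–Yin is PROVED here.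
-/

set_option autoImplicit false
set_option linter.dupNamespace false

noncomputable section

open scoped Classical

open WeierstrassCurve NumberField IsDedekindDomain Field PowerSeries
  Literature.NumberTheory.EllipticCurves Literature.NumberTheory.EllipticCurves.Rank1Residual
  Literature.NumberTheory.EllipticCurves.ModularForms
  Literature.NumberTheory.GaloisRepresentations Literature.NumberTheory.QuadraticFields
  Literature.NumberTheory.EllipticCurves.GreenbergSelmer
  Literature.NumberTheory.EllipticCurves.CastellaGrossiLeeSkinner2022
  Literature.NumberTheory.EllipticCurves.KellerYin2024
  Literature.NumberTheory.EllipticCurves.Hida2010MuInvariant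
  Summit.BirchSwinnertonDyer.Rank1Residual.X11b.Halves
  Summit.BirchSwinnertonDyer.BirchSwinnertonDyer.Theorems.EisensteinPrimesMuLambda

namespace Summit.BirchSwinnertonDyer.BirchSwinnertonDyer.Theorems.GoodLatticeAnacongOfCGLSProofThm221

/-! ## The assembly: 3a-A's conclusion from the named fact and Hida's Thm. I, GIVEN a full-descent type -/

/-- **[AN] (the conclusion of content stub 3a-A, Keller–Yin Thm. 2.2.2 shape) from CGLS's proof of Thm. 2.2.1 and Hida's
Thm. I, GIVEN a full-Eisenstein-descent type.** At the call shape of the tree's consumers of [AN] (`W/ℚ` globally minimal, odd good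
`p`, `Red`, `Anom`, (hlat); `K` imaginary quadratic with (Heeg) for `N_E` and `p`, `D_K` odd `≠ −3`; `ι, v, v̄, κ` anticyclotomic,
`γ`, `Dt`, `ι'`; a BDP frame `(Ω_K, Ω_p, L)`; a rational line `Φ` with Teichmüller lifts `θsub`, `θquot`; `Sf = {w : N_E ∈ w}`;
the Hecke character `θ_K` of `θquot|_{Γ_K}`; ANY Katz frame `(Ω_K', Ω_p', L_φ)` of `θ_K` at a ramified `Cbar`), and GIVEN a type
`(N₊, N₋, N₀)` with Kriz's conditions (1)–(5) for `φ̃ = θquot`: `∃ n n_φ, FirstUnitCoeffAt L n ∧ FirstUnitCoeffAt L_φ n_φ ∧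
n + Σ_{w∈Sf} λ𝒫_w(E) = 2·n_φ + Σ_{w∈Sf}(λ𝒫_w(θsub|_K) + λ𝒫_w(θquot|_K))`. Proof: `θquot` is `(p−1)`-torsion, unramified at `p`
(`goodLatticeQuotCharUnramifiedAtPOnTree_holds`) and off `N_E` (`isUnramifiedAt_of_isTeichmullerLiftOnQuot`), so Hida's fact gives
`FirstUnitCoeffAt L_φ n_φ`; the named fact gives the congruence; Kriz's (2)/(3) transported to `K`
(`GoodLatticeAnacongPlacementOfKriz`) are the consumer's placement congruences; `anacong_conclusion_of_eisensteinCongruence`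
concludes. CONDITIONAL on the two named facts. [cite: CastellaGrossiLeeSkinner2022, Thm. 2.2.1 and proof of Thm. 2.2.2 ((eq:Euler-comp), (2.16); arXiv:2008.02571v2 TeX L1051–1153)]
[cite: Hida2010MuInvariant, Thm. I (p. 45)] [cite: Kriz2016, Def. 31, Rem. 32, Thm. 34 (2)(3)] [cite: KellerYin2024, Thm. 2.2.2 (statement shape; arXiv:2402.12781v2 TeX L1445–1448)] -/
theorem anacong_of_proofThm221_of_thmI (h221 : proofThm221_congruence_of_fullEisensteinDescent)
    (hI : thmI_mu_katzLFunction_eq_zero) :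
    ∀ (W : WeierstrassCurve ℚ) [W.IsElliptic] [W.IsGloballyMinimal] (p : ℕ) [Fact p.Prime],
      2 < p → Good W p → Red W p → Anom W p →
      (∀ Φ : AddSubgroup (geomTorsion W (p : ℤ)), IsRationalLine W p Φ → ¬ LineUnramifiedAt W p Φ) →
      ∀ (K : Type) [Field K] [NumberField K], IsImaginaryQuadratic K →
        SatisfiesHeegnerHypothesis (W.conductorNorm ℤ) K → SatisfiesHeegnerHypothesis p K →
        Odd (NumberField.discr K) → NumberField.discr K ≠ -3 →
      ∀ (ι : K →+* ℚ_[p]) (v vbar : HeightOneSpectrum (𝓞 K)),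
        (∀ x : 𝓞 K, x ∈ v.asIdeal ↔ ‖ι (x : K)‖ < 1) →
        ((p : ℕ) : 𝓞 K) ∈ vbar.asIdeal → vbar ≠ v →
      ∀ (κ : ZpExtension K p), κ.IsAnticyclotomic →
      ∀ (γ : absoluteGaloisGroup K) [Fact (κ.IsTopGenerator γ)],
      ∀ (N : ℕ) [NeZero N] (Dt : ModularParametrizationData W N),
      ∀ (ι' : PadicAlgCl p ≃+* ℂ),
        (∀ (w : InfinitePlace K) (k : 𝓞 K), k ∈ v.asIdeal ↔ ‖ι'.symm (w.embedding (k : K))‖ < 1) →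
      ∀ (ΩK : ℂ) (Ωp : (unrIntegers p)ˣ) (L : UnrSeries p), ΩK ≠ 0 →
        IsBDPLFunction ι' v κ γ Dt.f ΩK ((Ωp : unrIntegers p) : ℂ_[p]) L →
      ∀ (Φ : AddSubgroup (geomTorsion W (p : ℤ))), IsRationalLine W p Φ →
      ∀ (θsub θquot : FramedGaloisRep ℚ (padicCoeffIntegers (∅ : Set (PadicAlgCl p))) 1),
        IsTeichmullerLiftOn (∅ : Set (PadicAlgCl p)) (Φ.map (geomTorsion W (p : ℤ)).subtype) θsub →
        IsTeichmullerLiftOnQuot (∅ : Set (PadicAlgCl p)) (Φ.map (geomTorsion W (p : ℤ)).subtype)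
          (geomTorsion W (p : ℤ)) θquot →
      -- the full-descent type `(N₊, N₋, N₀)` with Kriz's (1)–(5) for `φ̃ = θquot` (as in the named fact)
      ∀ (Nplus Nminus Nzero : Finset ℕ),
        Nplus ⊆ (W.conductorNorm ℤ).primeFactors → Nminus ⊆ (W.conductorNorm ℤ).primeFactors →
        Nzero ⊆ (W.conductorNorm ℤ).primeFactors →
        (∀ (ℓ : ℕ) (hℓ : ℓ ∈ (W.conductorNorm ℤ).primeFactors),
          haveI : Fact ℓ.Prime := ⟨Nat.prime_of_mem_primeFactors hℓ⟩
          (ℓ ∈ Nzero ↔ ¬ W.HasMultiplicativeReductionAtPrime ℓ) ∧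
          ((ℓ ∈ Nplus ∨ ℓ ∈ Nminus) ↔ W.HasMultiplicativeReductionAtPrime ℓ) ∧ ¬ (ℓ ∈ Nplus ∧ ℓ ∈ Nminus)) →
        (∀ (ℓ : ℕ) (u : HeightOneSpectrum (𝓞 ℚ)), ℓ.Prime → ((ℓ : ℕ) : 𝓞 ℚ) ∈ u.asIdeal →
          ¬ ℓ ∣ W.conductorNorm ℤ → ∀ a : padicCoeffIntegers (∅ : Set (PadicAlgCl p)),
          θquot.HasFrobCharpolyAt u (Polynomial.X - Polynomial.C a) →
          ‖((W.LFunction ℓ : ℤ) : PadicAlgCl p) - ((a : PadicAlgCl p) + (a : PadicAlgCl p)⁻¹ * (ℓ : PadicAlgCl p))‖ < 1) →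
        (∀ ℓ ∈ Nplus, ∀ u : HeightOneSpectrum (𝓞 ℚ), ((ℓ : ℕ) : 𝓞 ℚ) ∈ u.asIdeal → θquot.IsUnramifiedAt u ∧
          ∀ a : padicCoeffIntegers (∅ : Set (PadicAlgCl p)), θquot.HasFrobCharpolyAt u (Polynomial.X - Polynomial.C a) →
          ‖((W.LFunction ℓ : ℤ) : PadicAlgCl p) - (a : PadicAlgCl p)‖ < 1) →
        (∀ ℓ ∈ Nminus, ∀ u : HeightOneSpectrum (𝓞 ℚ), ((ℓ : ℕ) : 𝓞 ℚ) ∈ u.asIdeal → θquot.IsUnramifiedAt u ∧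
          ∀ a : padicCoeffIntegers (∅ : Set (PadicAlgCl p)), θquot.HasFrobCharpolyAt u (Polynomial.X - Polynomial.C a) →
          ‖((W.LFunction ℓ : ℤ) : PadicAlgCl p) - (a : PadicAlgCl p)⁻¹ * (ℓ : PadicAlgCl p)‖ < 1) →
        (∀ ℓ ∈ Nzero, ‖((W.LFunction ℓ : ℤ) : PadicAlgCl p)‖ < 1) →
        ((∀ σ : absoluteGaloisGroup ℚ, θquot σ = 1) →
          ‖(((1 : ℚ) / 24 * ((∏ ℓ ∈ Nplus, (1 - (ℓ : ℚ))) * (∏ _ℓ ∈ Nminus, ((1 : ℚ) - 1)) *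
              (∏ ℓ ∈ Nzero, (1 - (ℓ : ℚ)) * ((1 : ℚ) - 1))) : ℚ) : ℚ_[p])‖ < 1) →
      ∀ (Sf : Finset (HeightOneSpectrum (𝓞 K))),
        (∀ w : HeightOneSpectrum (𝓞 K), w ∈ Sf ↔ ((W.conductorNorm ℤ : ℤ) : 𝓞 K) ∈ w.asIdeal) →
      ∀ (θK : HeckeCharacter K), IsHeckeCharOf ι' (θquot.restrictField K) θK →
      ∀ (Cbar : Finset (HeightOneSpectrum (𝓞 K))), (∀ u ∈ Cbar, ¬ θK.IsUnramifiedAt u) →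
      ∀ (ΩK' : ℂ) (Ωp' : (unrIntegers p)ˣ) (Lφ : UnrSeries p), ΩK' ≠ 0 →
        IsKatzLFunction ι' v vbar Cbar κ γ θK ΩK' ((Ωp' : unrIntegers p) : ℂ_[p]) Lφ →
      ∃ n nφ : ℕ, FirstUnitCoeffAt L n ∧ FirstUnitCoeffAt Lφ nφ ∧
        n + ∑ w ∈ Sf, curveLocalLambda κ (W.baseChange K) w =
          2 * nφ + ∑ w ∈ Sf, (charLocalLambda ∅ κ (θsub.restrictField K) w + charLocalLambda ∅ κ (θquot.restrictField K) w) := by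
  intro W _ _ p _ hp hgood hred hanom hGL K _ _ hK hHN hHp hodd h3 ι v vbar hv hvbar hne κ hκ γ _ N _ Dt ι' hι'
    ΩK Ωp L hΩK hL Φ hΦ θsub θquot hsub hquot Nplus Nminus Nzero hNp hNm hNz htype h1 h2 h3' h4 h5 Sf hSf θK hθK Cbar hC
    ΩK' Ωp' Lφ hΩK' hLφ
  -- `θquot = φ̃`: `(p−1)`-torsion, unramified at `p` (good lattice at an anomalous `p`) and away from `N_E`
  have hT1 : ∀ σ : absoluteGaloisGroup ℚ, θquot σ ^ (p - 1) = 1 := hquot.1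
  have hcardΦ : Nat.card (Φ.map (geomTorsion W (p : ℤ)).subtype) = p := by
    rw [Nat.card_congr (Φ.equivMapOfInjective (geomTorsion W (p : ℤ)).subtype
      (geomTorsion W (p : ℤ)).subtype_injective).toEquiv.symm, hΦ.1]
  have hunrp : ∀ u : HeightOneSpectrum (𝓞 ℚ), ((p : ℕ) : 𝓞 ℚ) ∈ u.asIdeal → θquot.IsUnramifiedAt u :=
    goodLatticeQuotCharUnramifiedAtPOnTree_holds W p hp hgood hred hanom hGL Φ hΦ θquot hquot
  have hunr : ∀ u : HeightOneSpectrum (𝓞 ℚ), ((W.conductorNorm ℤ : ℤ) : 𝓞 ℚ) ∉ u.asIdeal →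
      θquot.IsUnramifiedAt u := by
    intro u hu
    by_cases hpu : ((p : ℕ) : 𝓞 ℚ) ∈ u.asIdeal
    · exact hunrp u hpu
    · exact isUnramifiedAt_of_isTeichmullerLiftOnQuot W ∅ hcardΦ hquot
        (hasGoodReductionAt_of_conductorNorm_notMem W u hu) hpu
  -- Hida's Theorem I at the given Katz frame
  obtain ⟨nφ, hnφ⟩ := hI p hp K hK hHp hodd h3 ι v vbar hv hvbar hne κ hκ γ ι' hι' θquot hT1 (W.conductorNorm ℤ) hHN
    hunr hunrp θK hθK Cbar hC ΩK' Ωp' Lφ hΩK' hLφ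
  -- CGLS's congruence from the named fact
  have hj : ∀ x : ℤ_[p], ((toUnr p x : unrIntegers p) : ℂ_[p]) = ((x : ℚ_[p]) : ℂ_[p]) := fun x ↦ by
    rw [coe_toUnr]; rfl
  obtain ⟨wl, Pq, Ps, U, hU, hwl, hPq, hPs, hcong⟩ := h221 W p hp hgood Φ hΦ θsub θquot hsub hquot hunrp Nplus Nminus
    Nzero hNp hNm hNz htype h1 h2 h3' h4 h5 K hK hHN hHp hodd h3 ι v vbar hv hvbar hne κ hκ γ N Dt ι' hι' ΩK Ωp L hΩK hL
    θK hθK Cbar hC ΩK' Ωp' Lφ hΩK' hLφ (toUnr p) hj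
  -- the residual pair over `K`
  have hpairK : IsResidualPairOver (W.baseChange K) p (θsub.restrictField K) (θquot.restrictField K) :=
    isResidualPairOver_restrictField W p K hΦ hsub hquot
  -- reduction types at the chosen places
  have hplace : ∀ ℓ ∈ (W.conductorNorm ℤ).primeFactors, ∀ (hℓ' : Fact ℓ.Prime),
      (W.HasMultiplicativeReductionAt ((wl ℓ).under (𝓞 ℚ)) ↔ W.HasMultiplicativeReductionAtPrime ℓ) := by
    intro ℓ hℓ hℓ'
    have hℓu : ((ℓ : ℕ) : 𝓞 ℚ) ∈ ((wl ℓ).under (𝓞 ℚ)).asIdeal := by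
      change ((ℓ : ℕ) : 𝓞 ℚ) ∈ (wl ℓ).asIdeal.comap (algebraMap (𝓞 ℚ) (𝓞 K))
      rw [Ideal.mem_comap, map_natCast]; exact hwl ℓ hℓ
    have hvℓ : ((Rat.HeightOneSpectrum.primesEquiv ((wl ℓ).under (𝓞 ℚ)) : Nat.Primes) : ℕ) = ℓ :=
      Rat.HeightOneSpectrum.primesEquiv_eq_of_natCast_mem _ hℓ'.out hℓu
    have key : ∀ (q : ℕ) (hq' : Fact q.Prime), q = ℓ →
        ((haveI := hq'; W.HasMultiplicativeReductionAtPrime q) ↔ W.HasMultiplicativeReductionAtPrime ℓ) := by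
      rintro q hq' rfl; exact Iff.rfl
    rw [← key _ _ hvℓ]
    exact (W.hasMultiplicativeReductionAtPrime_iff_hasMultiplicativeReductionAt_ringOfIntegers ((wl ℓ).under (𝓞 ℚ))).symm
  have hzero : ∀ ℓ ∈ (W.conductorNorm ℤ).primeFactors,
      (ℓ ∈ Nzero ↔ ¬ W.HasMultiplicativeReductionAt ((wl ℓ).under (𝓞 ℚ))) := by
    intro ℓ hℓ
    haveI : Fact ℓ.Prime := ⟨Nat.prime_of_mem_primeFactors hℓ⟩
    rw [hplace ℓ hℓ]
    exact (htype ℓ hℓ).1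
  have hpm : ∀ ℓ ∈ (W.conductorNorm ℤ).primeFactors,
      W.HasMultiplicativeReductionAt ((wl ℓ).under (𝓞 ℚ)) → (ℓ ∈ Nplus ↔ ℓ ∉ Nminus) := by
    intro ℓ hℓ hm
    haveI : Fact ℓ.Prime := ⟨Nat.prime_of_mem_primeFactors hℓ⟩
    have hm' := (hplace ℓ hℓ inferInstance).mp hm
    obtain ⟨-, hor, hnand⟩ := htype ℓ hℓ
    have hor' := hor.mpr hm'
    constructor
    · exact fun hP hM ↦ hnand ⟨hP, hM⟩
    · intro hM
      exact hor'.resolve_right hM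
  have hplus : ∀ ℓ ∈ Nplus, W.HasMultiplicativeReductionAt ((wl ℓ).under (𝓞 ℚ)) →
      ∃ a : padicCoeffIntegers (∅ : Set (PadicAlgCl p)),
        (θquot.restrictField K).HasFrobCharpolyAt (wl ℓ) (Polynomial.X - Polynomial.C a) ∧
        ‖(a : PadicAlgCl p) -
          (if W.HasSplitMultiplicativeReductionAt ((wl ℓ).under (𝓞 ℚ)) then (1 : PadicAlgCl p) else -1)‖ < 1 :=
    fun ℓ hℓ hm ↦ GoodLatticeAnacongPlacementOfKriz.placement_plus_of_kriz W K hK hHN (hNp hℓ) (hwl ℓ (hNp hℓ)) hm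
      (h2 ℓ hℓ)
  have hminus : ∀ ℓ ∈ Nminus, W.HasMultiplicativeReductionAt ((wl ℓ).under (𝓞 ℚ)) →
      ∃ a : padicCoeffIntegers (∅ : Set (PadicAlgCl p)),
        (θsub.restrictField K).HasFrobCharpolyAt (wl ℓ) (Polynomial.X - Polynomial.C a) ∧
        ‖(a : PadicAlgCl p) -
          (if W.HasSplitMultiplicativeReductionAt ((wl ℓ).under (𝓞 ℚ)) then (1 : PadicAlgCl p) else -1)‖ < 1 :=
    fun ℓ hℓ hm ↦ GoodLatticeAnacongPlacementOfKriz.placement_minus_of_kriz W K hp hgood hred hanom hGL hK hHN hHp hpairK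
      (hNm hℓ) (hwl ℓ (hNm hℓ)) hm (h3' ℓ hℓ)
  -- the consumer
  obtain ⟨n, hn, hid⟩ :=
    GoodLatticeAnacongOfEisensteinCongruence.anacong_conclusion_of_eisensteinCongruence W K hp hgood hred hanom hGL hK hHN
      hHp hκ hpairK Sf hSf wl hwl Nzero Nplus Nminus hNz hNp hNm hzero hpm hplus hminus Pq Ps
      (fun ℓ hℓ ↦ (hPq ℓ hℓ).1) (fun ℓ hℓ ↦ (hPq ℓ hℓ).2) (fun ℓ hℓ ↦ (hPs ℓ hℓ).1) (fun ℓ hℓ ↦ (hPs ℓ hℓ).2) hU hnφ hcong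
  exact ⟨n, nφ, hn, hnφ, hid⟩

end Summit.BirchSwinnertonDyer.BirchSwinnertonDyer.Theorems.GoodLatticeAnacongOfCGLSProofThm221

end
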